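import Mathlib
import HarnessLib
import Summits.FinalStateConjecture.FinalStateConjecture.Theses.ZeroEnergyKerrOrBomb
import Literature.Geometry.Lorentzian.Stationary
import Literature.Geometry.Lorentzian.Geodesic
import Literature.Geometry.Lorentzian.Causality

/-!
# Sketch — first lemmas of the three crux ideas for `ErgoregionBomb`
(crux-ideate round 1, ideator 3; statements only, proofs are not claimed here)

* `holonomy_le_one_of_complete` — card `zero-energy-surface-gravity`;
* `kelvin_tait_chetaev` — card `krein-signed-feshbach-pencil`;
* `killingModePair_orbit_law` — card `upper-half-plane-absorption`.
-/

noncomputable section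

open Set Manifold
open scoped Manifold Topology Matrix

namespace Summit.FinalStateConjecture.FinalStateConjecture.Cruxes.ErgoregionBomb.SketchIdeator3

open Literature.Geometry.Lorentzian

/-- **Affine holonomy of a trapped zero-energy ray vs. future completeness** (card
`zero-energy-surface-gravity`, first lemma). If a curve `γ`, continuous on `[0, ∞)` (e.g. an
affinely parametrised geodesic on `Set.Ici 0` as in the crux), returns modulo an isometry `Φ`
that advances a Killing time `t` by `t₀ > 0` — `γ (s₀ + s/μ) = Φ (γ s)` for all `s ≥ 0`
(the self-similarity forced by geodesic uniqueness once `γ(s₀) = Φ(γ 0)` and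
`γ̇(s₀) = μ · dΦ(γ̇ 0)`) — then the holonomy factor satisfies `μ ≤ 1`: a blueshifting
(`μ > 1`) return would exhaust the parameter domain at `s_∞ = s₀ μ/(μ-1) < ∞` while Killing time
diverges, contradicting continuity of `t ∘ γ` on the compact `[0, s_∞]`. Pure topology/real
analysis; the geometric inputs enter only through the hypotheses. -/
theorem holonomy_le_one_of_complete {X : Type*} [TopologicalSpace X]
    (γ : ℝ → X) (t : X → ℝ) (Φ : X → X) (s₀ t₀ μ : ℝ)
    (hγ : ContinuousOn γ (Set.Ici 0)) (ht : Continuous t)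
    (hs₀ : 0 < s₀) (ht₀ : 0 < t₀) (hμ : 0 < μ)
    (hΦ : ∀ x, t (Φ x) = t x + t₀)
    (hret : ∀ s, 0 ≤ s → γ (s₀ + s / μ) = Φ (γ s)) : μ ≤ 1 := by
  sorry

/-- The same lemma phrased on the crux's telescope: a zero-energy null geodesic of a stationary
black hole `𝓑`, affinely parametrised on `[0, ∞)` as in `ErgoregionBomb`, which is periodic
modulo a map `Φ` advancing a continuous Killing time function `t` (`t ∘ Φ = t + t₀`), has
holonomy `μ ≤ 1` (no net blueshift per period). -/
theorem zeroEnergyRay_holonomy_le_one (𝓑 : StationaryAFBlackHole.{0}) [𝓑.metric.HasLeviCivita]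
    (γ : ℝ → 𝓑.carrier) (hγ : IsGeodesicOn 𝓑.metric.leviCivita γ (Set.Ici 0))
    (hcont : ContinuousOn γ (Set.Ici 0))
    (hz : ∀ s : ℝ, 0 ≤ s → 𝓑.metric.IsNull (velocity (𝓡 4) γ s) ∧
      𝓑.metric.val (γ s) (𝓑.killing (γ s)) (velocity (𝓡 4) γ s) = 0)
    (t : 𝓑.carrier → ℝ) (ht : Continuous t) (Φ : 𝓑.carrier → 𝓑.carrier) (s₀ t₀ μ : ℝ)
    (hs₀ : 0 < s₀) (ht₀ : 0 < t₀) (hμ : 0 < μ) (hΦ : ∀ x, t (Φ x) = t x + t₀)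
    (hret : ∀ s, 0 ≤ s → γ (s₀ + s / μ) = Φ (γ s)) : μ ≤ 1 :=
  holonomy_le_one_of_complete γ t Φ s₀ t₀ μ hcont ht hs₀ ht₀ hμ hΦ hret

/-- **Kelvin–Tait–Chetaev (complete dissipation destroys gyroscopic stabilisation)** (card
`krein-signed-feshbach-pencil`, first lemma = the finite-dimensional core of the lever). For the
quadratic pencil `λ² M + λ (G + D) + K` with `M` and `D` positive definite, `G` skew and `K`
symmetric, non-singular, with a negative direction, there is an eigenvalue with `Re λ > 0`
(Zajac 1964; Krechetnikov–Marsden, Rev. Mod. Phys. 79 (2007), §III): no eigenvalue can sit on the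
imaginary axis (imaginary part of `v* (…) v` is `Im λ · v* D v`), and along the homotopy `G ↦ sG`
the number of right-half-plane eigenvalues is therefore constant, equal to the negative index of
`K` at `s = 0`. -/
theorem kelvin_tait_chetaev {n : ℕ} (M D K G : Matrix (Fin n) (Fin n) ℝ)
    (hM : M.PosDef) (hD : D.PosDef) (hK : K.IsSymm) (hG : G.transpose = -G)
    (hKdet : K.det ≠ 0) (hneg : ∃ v : Fin n → ℝ, v ⬝ᵥ (K *ᵥ v) < 0) :
    ∃ z : ℂ, 0 < z.re ∧
      (z ^ 2 • M.map (algebraMap ℝ ℂ) + z • (G + D).map (algebraMap ℝ ℂ) +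
        K.map (algebraMap ℝ ℂ)).det = 0 := by
  sorry

/-- **Exponential law of a Killing-mode pair along the stationary flow** (card
`upper-half-plane-absorption`, first lemma): along an integral curve `c` of `T` inside the d.o.c.,
a Killing-mode pair `(ψ, χ)` of frequency `ν + iω` (the eigen-relations of the crux's conclusion)
satisfies `ψ² + χ² ∘ c = e^{2νt} (ψ² + χ²)(c 0)` — the pointwise form of
`Ψ ∘ φ_t = e^{(ν+iω)t} Ψ`, i.e. Killing-mode pairs are exactly the `e^{-iσ t*}`-separated
solutions (`σ = -ω + iν`), the kernel of the reduced operator `P(σ)` on the orbit space. -/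
theorem killingModePair_orbit_law (𝓑 : StationaryAFBlackHole.{0}) [𝓑.metric.HasLeviCivita]
    (ν ω : ℝ) (ψ χ : 𝓑.carrier → ℝ) (c : ℝ → 𝓑.carrier)
    (hc : IsMIntegralCurve c 𝓑.killing) (hdoc : ∀ t, c t ∈ 𝓑.doc)
    (hψ : ∀ t, MDifferentiableAt (𝓡 4) 𝓘(ℝ, ℝ) ψ (c t))
    (hχ : ∀ t, MDifferentiableAt (𝓡 4) 𝓘(ℝ, ℝ) χ (c t))
    (hmode : ∀ x ∈ 𝓑.doc, mfderiv (𝓡 4) 𝓘(ℝ, ℝ) ψ x (𝓑.killing x) = ν * ψ x - ω * χ x ∧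
      mfderiv (𝓡 4) 𝓘(ℝ, ℝ) χ x (𝓑.killing x) = ω * ψ x + ν * χ x) :
    ∀ t : ℝ, ψ (c t) ^ 2 + χ (c t) ^ 2 = Real.exp (2 * ν * t) * (ψ (c 0) ^ 2 + χ (c 0) ^ 2) := by
  sorry

/-- Consequence used by the line (past-boundedness test): a Killing-mode pair with `ν > 0` that is
bounded along the whole forward orbit `{c t : t ≥ 0}` of a point of the d.o.c. vanishes on that
orbit. -/
theorem killingModePair_eq_zero_of_bounded_forward (𝓑 : StationaryAFBlackHole.{0})
    [𝓑.metric.HasLeviCivita]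
    (ν ω : ℝ) (hν : 0 < ν) (ψ χ : 𝓑.carrier → ℝ) (c : ℝ → 𝓑.carrier)
    (hc : IsMIntegralCurve c 𝓑.killing) (hdoc : ∀ t, c t ∈ 𝓑.doc)
    (hψ : ∀ t, MDifferentiableAt (𝓡 4) 𝓘(ℝ, ℝ) ψ (c t))
    (hχ : ∀ t, MDifferentiableAt (𝓡 4) 𝓘(ℝ, ℝ) χ (c t))
    (hmode : ∀ x ∈ 𝓑.doc, mfderiv (𝓡 4) 𝓘(ℝ, ℝ) ψ x (𝓑.killing x) = ν * ψ x - ω * χ x ∧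
      mfderiv (𝓡 4) 𝓘(ℝ, ℝ) χ x (𝓑.killing x) = ω * ψ x + ν * χ x)
    (hbdd : ∃ C : ℝ, ∀ t : ℝ, 0 ≤ t → |ψ (c t)| ≤ C ∧ |χ (c t)| ≤ C) :
    ψ (c 0) = 0 ∧ χ (c 0) = 0 := by
  sorry


/-- **Killing-mode pair ⟺ T-invariant reduced amplitude** (card `upper-half-plane-absorption`,
first lemma, replacing `killingModePair_orbit_law` which the disprover proved independently as
`Disproof.modePair_sq_eq_exp`, 2026-08-16T00:59Z). Given a Killing time `t` on the d.o.c.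
(`dt(T) = 1`), the pair `(ψ, χ)` satisfies the crux's eigen-relations `dψ(T) = νψ − ωχ`,
`dχ(T) = ωψ + νχ` on the d.o.c. iff the reduced amplitudes
`u₁ = e^{-νt}(ψ cos ωt + χ sin ωt)`, `u₂ = e^{-νt}(χ cos ωt − ψ sin ωt)` are `T`-invariant there —
i.e. `Ψ = e^{(ν+iω)t}(u₁ + i u₂)` with `u` a function on the orbit space: the kernel of the reduced
operator `P(σ)`. This is the typable half of "pole of `P(·)⁻¹` ⟺ Killing-mode pair". -/
theorem killingModePair_iff_reduced_invariant (𝓑 : StationaryAFBlackHole.{0})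
    [𝓑.metric.HasLeviCivita] (ν ω : ℝ) (ψ χ t : 𝓑.carrier → ℝ)
    (ht : ∀ x ∈ 𝓑.doc, MDifferentiableAt (𝓡 4) 𝓘(ℝ, ℝ) t x ∧
      mfderiv (𝓡 4) 𝓘(ℝ, ℝ) t x (𝓑.killing x) = 1)
    (hψ : ∀ x ∈ 𝓑.doc, MDifferentiableAt (𝓡 4) 𝓘(ℝ, ℝ) ψ x)
    (hχ : ∀ x ∈ 𝓑.doc, MDifferentiableAt (𝓡 4) 𝓘(ℝ, ℝ) χ x) :
    (∀ x ∈ 𝓑.doc, mfderiv (𝓡 4) 𝓘(ℝ, ℝ) ψ x (𝓑.killing x) = ν * ψ x - ω * χ x ∧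
        mfderiv (𝓡 4) 𝓘(ℝ, ℝ) χ x (𝓑.killing x) = ω * ψ x + ν * χ x) ↔
      (∀ x ∈ 𝓑.doc,
        mfderiv (𝓡 4) 𝓘(ℝ, ℝ)
            (fun y ↦ Real.exp (-(ν * t y)) * (ψ y * Real.cos (ω * t y) + χ y * Real.sin (ω * t y)))
            x (𝓑.killing x) = 0 ∧
          mfderiv (𝓡 4) 𝓘(ℝ, ℝ)
            (fun y ↦ Real.exp (-(ν * t y)) * (χ y * Real.cos (ω * t y) - ψ y * Real.sin (ω * t y)))
            x (𝓑.killing x) = 0) := by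
  sorry

/-- **Forward `T`-orbits leave the past of the far slice region** (card `upper-half-plane-absorption`,
second lemma: "outgoing ⟺ bounded on `doc ∩ I⁻(far slice)`"). On a globally hyperbolic hole whose
embedded far slice region is achronal, for every point `x` of the d.o.c. the integral curve of `T`
through `x` is eventually outside `I⁻(embed (Σ_far))` — so a growing Killing mode `e^{νt}u` is
tested for boundedness only on a past half-orbit, where `e^{νt}` is harmless, and the clause is a
condition at spatial infinity (outgoing vs. incoming), as the refuters observed. -/
theorem forwardOrbit_eventually_notMem_past_far (𝓑 : StationaryAFBlackHole.{0})
    [𝓑.metric.HasLeviCivita] (hgh : 𝓑.metric.IsGloballyHyperbolic 𝓑.timeOrientation)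
    (hachr : ∀ p ∈ 𝓑.embed '' 𝓑.e.far (𝓑.e.R + 1),
      p ∉ 𝓑.metric.chronologicalPast 𝓑.timeOrientation (𝓑.embed '' 𝓑.e.far (𝓑.e.R + 1)))
    {x : 𝓑.carrier} (hx : x ∈ 𝓑.doc) {c : ℝ → 𝓑.carrier} (hc : IsMIntegralCurve c 𝓑.killing)
    (h0 : c 0 = x) :
    ∃ t₁ : ℝ, ∀ s : ℝ, t₁ ≤ s →
      c s ∉ 𝓑.metric.chronologicalPast 𝓑.timeOrientation (𝓑.embed '' 𝓑.e.far (𝓑.e.R + 1)) := by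
  sorry

end Summit.FinalStateConjecture.FinalStateConjecture.Cruxes.ErgoregionBomb.SketchIdeator3
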